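import Mathlib.Data.Real.Basic
import Mathlib.Order.Interval.Set.Basic
import Mathlib.Tactic
import HarnessLib

/-!
# The PICTURE / HARTREE-REFERENCE map of a three-band charge-transfer entry: which bare
# hole-picture `Δ_pd` a printed electron-picture, fluctuation-form level difference denotes, and
# the box inflation the translation carries

Venture CertifiedManyBodySolver, cell `pub/hubbard-downfold` (stage S1 = downfolding front end; HUMAN
RULINGS D-0096/D-0098: reduction and convention errors are carried as explicit box inflation, never
hidden), seat hubbard-downfold-mod-3 (technique A, cell file `router/INFLATION-RULES.md` §3to1-A
A.14); namespace `Summit.Ventures.CertifiedManyBodySolver.Downfold.PictureMap`. Everything here is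
PROVED (elementary real identities and interval enclosures). WHAT THIS IS NOT: a statement about
any material; not a derivation of the operator identity behind the map (that is three lines of
normal ordering, recorded in the cell file A.14 (1)); not a ruling on which reading a given printed
table uses (the cell decides that by reproducing the source's own printed level shift, A.14 (3)).

The situation the adapter `Downfold.S2SeamEmery` (seat mod-4) names in prose — "the level object
(bare Wannier level vs double-counting-corrected level) is the TAG OF RECORD of the box's `Delta_pd`
entry" — made quantitative. A density–density three-band (`d`, `p_x`, `p_y`) model with on-site
`U_d`, `U_p` and nearest-neighbour `V = V_pd` (each Cu has `z_d = 4` O neighbours, each O has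
`z_p = 2` Cu neighbours) can print its charge-transfer entry in three inequivalent ways:

* `Δ^e`  — BARE electron levels `ε_d − ε_p` of the normal-ordered electron Hamiltonian;
* `Δ^fl` — FLUCTUATION-FORM (mean-field-referenced) levels `ε^fl_i = ε_i + U_i n̄_i/2 + Σ_j V_ij n̄_j`
  at reference electron occupations `(n̄_d, n̄_p)` — the form in which constrained-GW / cRPA schemes
  print their one-body part (the Kohn–Sham / GW level carries the Hartree field of the target
  electrons; the interaction is then solved "after eliminating the double counting in the Hartree
  terms", i.e. as `U (n↑ − n̄/2)(n↓ − n̄/2)`, `V (n_i − n̄_i)(n_j − n̄_j)`);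
* `Δ^h`  — BARE hole levels `ε^h_p − ε^h_d` of the normal-ordered HOLE Hamiltonian (vacuum `d¹⁰p⁶`;
  the convention of cluster / constrained-LDA parameter sets and of the cell's torus solver).

With hole occupations `h = 2 − n̄` the three are related by (A.14 (1)):
`Δ^e = Δ^fl − U_d n̄_d/2 + U_p n̄_p/2 − V (4 n̄_p − 2 n̄_d)`,
`Δ^h = Δ^e + (U_d − U_p) + 4 V = Δ^fl + U_d h_d/2 − U_p h_p/2 + V (4 h_p − 2 h_d)`.

* §1 the three entries as functions of `(Δ^fl, U_d, U_p, V, n̄_d, n̄_p)` and the identities between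
  them (`deltaH_eq_deltaE_add`, `deltaH_eq_fl_add_hartree`); particle–hole COVARIANCE of the
  fluctuation form (`holeFluct_eq_deltaFl`: re-referencing the bare hole levels at the hole
  occupations returns the printed number — the printed entry does not know the picture, the bare
  ones do); the no-interaction degeneration (`deltaH_eq_deltaFl_of_free`).
* §2 the BOX INFLATION of the translation at fixed reference occupations: `Δ^h` is affine in
  `(Δ^fl, U_d, U_p, V)` with coefficients `(1, h_d/2, −h_p/2, 4h_p − 2h_d)`, hence on a product box it
  is enclosed by two corner evaluations (`deltaH_mem_Icc_of_box`, sign of the `V` coefficient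
  supplied as a hypothesis in each direction) and its width is EXACTLY
  `w(Δ^fl) + (h_d/2) w(U_d) + (h_p/2) w(U_p) + |4h_p − 2h_d| w(V)` (`deltaH_width`): the hole-picture
  `Δ_pd` row of a three-band companion box inherits the widths of its `U` rows — the number the
  router's inflation rule for this step must print.

Sources (prose, no key is load-bearing): the fluctuation form and the solve-time subtraction —
T. Misawa, K. Nakamura, M. Imada, J. Phys. Soc. Jpn. 80, 023704 (2011) p. 2 (`μ̃_ν = μ_ν + Σ U_νν' n_ν'
+ U_νν n_ν/2`, "already included in the LDA … we correct μ_ν"); M. Hirayama, T. Misawa, T. Ohgoe,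
Y. Yamaji, M. Imada, Phys. Rev. B 99, 245155 (2019) §II.A ("the double counting of Hartree energy is
subtracted when the effective Hamiltonian is solved"); the hole-picture cluster convention —
M. S. Hybertsen, E. B. Stechel, M. Schlüter, D. R. Jennison, Phys. Rev. B 41, 11068 (1990).
-/

noncomputable section

namespace Summit.Ventures.CertifiedManyBodySolver.Downfold.PictureMap

/-! ## §1 The three charge-transfer entries of one density–density three-band set -/

/-- Hole occupation of an orbital with electron occupation `n` (two spin-orbitals per orbital). -/
def holeOcc (n : ℝ) : ℝ := 2 - n

/-- **Bare electron-picture charge-transfer entry** `Δ^e = ε_d − ε_p` of the normal-ordered electron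
Hamiltonian, from the printed fluctuation-form entry `Δfl` at reference electron occupations
`(nd, np)` with interactions `Ud, Up, V` (`z_d = 4`, `z_p = 2`): the Hartree reference
`U_i n̄_i/2 + Σ_j V n̄_j` is removed from each level. -/
def deltaE (Δfl Ud Up V nd np : ℝ) : ℝ :=
  Δfl - Ud * nd / 2 + Up * np / 2 - V * (4 * np - 2 * nd)

/-- **Bare hole-picture charge-transfer entry** `Δ^h = ε^h_p − ε^h_d` (vacuum `d¹⁰p⁶`, explicit
`Ud, Up, V` among holes — the cluster / torus-solver convention), from the printed fluctuation-form
entry at reference electron occupations `(nd, np)`. -/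
def deltaH (Δfl Ud Up V nd np : ℝ) : ℝ :=
  Δfl + Ud * (2 - nd) / 2 - Up * (2 - np) / 2 + V * (4 * (2 - np) - 2 * (2 - nd))

/-- **Fluctuation-form entry recomputed in the HOLE picture**: the bare hole levels re-referenced at
hole occupations `(hd, hp)`, `ε^{h,fl}_i = ε^h_i + U_i h_i/2 + Σ_j V h_j`, differenced as `p − d`. -/
def holeFluct (Δh Ud Up V hd hp : ℝ) : ℝ :=
  Δh + Up * hp / 2 + 2 * V * hd - Ud * hd / 2 - 4 * V * hp

/-- The particle–hole map of the normal-ordered Hamiltonian: `Δ^h = Δ^e + (U_d − U_p) + 2 V (z_d − z_p)`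
with `z_d − z_p = 2` (the one-body coefficient an electron level picks up when `n^e = 2 − n^h` is
substituted into `U n↑n↓` and `V n_i n_j` and the result is normal-ordered in hole operators). -/
theorem deltaH_eq_deltaE_add (Δfl Ud Up V nd np : ℝ) :
    deltaH Δfl Ud Up V nd np = deltaE Δfl Ud Up V nd np + (Ud - Up) + 4 * V := by
  unfold deltaH deltaE; ring

/-- **The map of record (cell file A.14 (1), reading H1):**
`Δ^h = Δ^fl + U_d h_d/2 − U_p h_p/2 + V (4 h_p − 2 h_d)` with `h = 2 − n̄`. -/
theorem deltaH_eq_fl_add_hartree (Δfl Ud Up V nd np : ℝ) :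
    deltaH Δfl Ud Up V nd np =
      Δfl + Ud * holeOcc nd / 2 - Up * holeOcc np / 2 + V * (4 * holeOcc np - 2 * holeOcc nd) := by
  unfold deltaH holeOcc; ring

/-- **Particle–hole covariance of the fluctuation form**: re-referencing the bare hole entry at the
hole occupations `2 − n̄` returns exactly the printed entry — a fluctuation-form number does not
determine a picture; only the bare entries differ between pictures. -/
theorem holeFluct_eq_deltaFl (Δfl Ud Up V nd np : ℝ) :
    holeFluct (deltaH Δfl Ud Up V nd np) Ud Up V (holeOcc nd) (holeOcc np) = Δfl := by
  unfold holeFluct deltaH holeOcc; ring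

/-- Without interactions all three entries coincide (here: `Δ^h = Δ^fl`). -/
theorem deltaH_eq_deltaFl_of_free (Δfl nd np : ℝ) : deltaH Δfl 0 0 0 nd np = Δfl := by
  unfold deltaH; ring

/-- Without interactions `Δ^e = Δ^fl` as well. -/
theorem deltaE_eq_deltaFl_of_free (Δfl nd np : ℝ) : deltaE Δfl 0 0 0 nd np = Δfl := by
  unfold deltaE; ring

/-- The "V absorbed at mean field" variant used by V-less solvers: dropping the explicit `V` while
keeping its Hartree field in the levels is the map with `V := 0` applied to the SAME printed entry;
the two hole entries then differ by exactly the explicit-`V` term. -/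
theorem deltaH_sub_deltaH_noV (Δfl Ud Up V nd np : ℝ) :
    deltaH Δfl Ud Up V nd np - deltaH Δfl Ud Up 0 nd np = V * (4 * (2 - np) - 2 * (2 - nd)) := by
  unfold deltaH; ring

/-- At one hole per `CuO₂` cell (`h_d + 2 h_p = 1`, undoped reference) the `V` coefficient reads
`4 h_p − 2 h_d = 2 − 4 h_d`: it is NEGATIVE exactly when more than half of the hole sits on Cu. -/
theorem vCoeff_of_one_hole {hd hp : ℝ} (h : hd + 2 * hp = 1) : 4 * hp - 2 * hd = 2 - 4 * hd := by
  linarith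

/-! ## §2 Box inflation of the translation (fixed reference occupations) -/

/-- `Δ^h` is non-decreasing in the printed entry. -/
theorem deltaH_mono_fl {a b Ud Up V nd np : ℝ} (hab : a ≤ b) :
    deltaH a Ud Up V nd np ≤ deltaH b Ud Up V nd np := by
  unfold deltaH; linarith

/-- `Δ^h` is non-decreasing in `U_d` when the Cu hole occupation is non-negative (`n̄_d ≤ 2`). -/
theorem deltaH_mono_Ud {Δfl a b Up V nd np : ℝ} (hnd : nd ≤ 2) (hab : a ≤ b) :
    deltaH Δfl a Up V nd np ≤ deltaH Δfl b Up V nd np := by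
  unfold deltaH; nlinarith

/-- `Δ^h` is non-increasing in `U_p` when the O hole occupation is non-negative (`n̄_p ≤ 2`). -/
theorem deltaH_anti_Up {Δfl Ud a b V nd np : ℝ} (hnp : np ≤ 2) (hab : a ≤ b) :
    deltaH Δfl Ud b V nd np ≤ deltaH Δfl Ud a V nd np := by
  unfold deltaH; nlinarith

/-- `Δ^h` is non-increasing in `V` when the `V` coefficient `4 h_p − 2 h_d` is non-positive (the
cuprate case: more than half of the hole on Cu). -/
theorem deltaH_anti_V {Δfl Ud Up a b nd np : ℝ} (hc : 4 * (2 - np) - 2 * (2 - nd) ≤ 0) (hab : a ≤ b) :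
    deltaH Δfl Ud Up b nd np ≤ deltaH Δfl Ud Up a nd np := by
  unfold deltaH; nlinarith

/-- `Δ^h` is non-decreasing in `V` when the `V` coefficient is non-negative. -/
theorem deltaH_mono_V {Δfl Ud Up a b nd np : ℝ} (hc : 0 ≤ 4 * (2 - np) - 2 * (2 - nd)) (hab : a ≤ b) :
    deltaH Δfl Ud Up a nd np ≤ deltaH Δfl Ud Up b nd np := by
  unfold deltaH; nlinarith

/-- **Corner enclosure, cuprate sign case.** On a product box
`[Δlo, Δhi] × [udlo, udhi] × [uplo, uphi] × [vlo, vhi]` with non-negative reference hole occupations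
and a non-positive `V` coefficient, the bare hole entry lies between the two MIXED corners
(`U_p` and `V` enter at their upper ends in the lower corner). -/
theorem deltaH_mem_Icc_of_box {Δfl Ud Up V nd np Δlo Δhi udlo udhi uplo uphi vlo vhi : ℝ}
    (hnd : nd ≤ 2) (hnp : np ≤ 2) (hc : 4 * (2 - np) - 2 * (2 - nd) ≤ 0)
    (hΔ : Δfl ∈ Set.Icc Δlo Δhi) (hUd : Ud ∈ Set.Icc udlo udhi) (hUp : Up ∈ Set.Icc uplo uphi)
    (hV : V ∈ Set.Icc vlo vhi) :
    deltaH Δfl Ud Up V nd np ∈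
      Set.Icc (deltaH Δlo udlo uphi vhi nd np) (deltaH Δhi udhi uplo vlo nd np) := by
  rcases hΔ with ⟨h1, h2⟩; rcases hUd with ⟨h3, h4⟩; rcases hUp with ⟨h5, h6⟩; rcases hV with ⟨h7, h8⟩
  constructor
  · calc deltaH Δlo udlo uphi vhi nd np ≤ deltaH Δfl udlo uphi vhi nd np := deltaH_mono_fl h1
      _ ≤ deltaH Δfl Ud uphi vhi nd np := deltaH_mono_Ud hnd h3
      _ ≤ deltaH Δfl Ud Up vhi nd np := deltaH_anti_Up hnp h6
      _ ≤ deltaH Δfl Ud Up V nd np := deltaH_anti_V hc h8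
  · calc deltaH Δfl Ud Up V nd np ≤ deltaH Δfl Ud Up vlo nd np := deltaH_anti_V hc h7
      _ ≤ deltaH Δfl Ud uplo vlo nd np := deltaH_anti_Up hnp h5
      _ ≤ deltaH Δfl udhi uplo vlo nd np := deltaH_mono_Ud hnd h4
      _ ≤ deltaH Δhi udhi uplo vlo nd np := deltaH_mono_fl h2

/-- **Corner enclosure, opposite sign case** (`V` coefficient non-negative: `V` enters at its lower
end in the lower corner). -/
theorem deltaH_mem_Icc_of_box' {Δfl Ud Up V nd np Δlo Δhi udlo udhi uplo uphi vlo vhi : ℝ}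
    (hnd : nd ≤ 2) (hnp : np ≤ 2) (hc : 0 ≤ 4 * (2 - np) - 2 * (2 - nd))
    (hΔ : Δfl ∈ Set.Icc Δlo Δhi) (hUd : Ud ∈ Set.Icc udlo udhi) (hUp : Up ∈ Set.Icc uplo uphi)
    (hV : V ∈ Set.Icc vlo vhi) :
    deltaH Δfl Ud Up V nd np ∈
      Set.Icc (deltaH Δlo udlo uphi vlo nd np) (deltaH Δhi udhi uplo vhi nd np) := by
  rcases hΔ with ⟨h1, h2⟩; rcases hUd with ⟨h3, h4⟩; rcases hUp with ⟨h5, h6⟩; rcases hV with ⟨h7, h8⟩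
  constructor
  · calc deltaH Δlo udlo uphi vlo nd np ≤ deltaH Δfl udlo uphi vlo nd np := deltaH_mono_fl h1
      _ ≤ deltaH Δfl Ud uphi vlo nd np := deltaH_mono_Ud hnd h3
      _ ≤ deltaH Δfl Ud Up vlo nd np := deltaH_anti_Up hnp h6
      _ ≤ deltaH Δfl Ud Up V nd np := deltaH_mono_V hc h7
  · calc deltaH Δfl Ud Up V nd np ≤ deltaH Δfl Ud Up vhi nd np := deltaH_mono_V hc h8
      _ ≤ deltaH Δfl Ud uplo vhi nd np := deltaH_anti_Up hnp h5
      _ ≤ deltaH Δfl udhi uplo vhi nd np := deltaH_mono_Ud hnd h4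
      _ ≤ deltaH Δhi udhi uplo vhi nd np := deltaH_mono_fl h2

/-- **The width of the translated row (the inflation number of this step).** The two corners of
`deltaH_mem_Icc_of_box` differ by exactly
`(Δhi − Δlo) + (h_d/2)(udhi − udlo) + (h_p/2)(uphi − uplo) + (2h_d − 4h_p)(vhi − vlo)`:
the hole-picture `Δ_pd` row inherits the printed row's width PLUS occupation-weighted widths of the
`U_d`, `U_p`, `V` rows. -/
theorem deltaH_width (Δlo Δhi udlo udhi uplo uphi vlo vhi nd np : ℝ) :
    deltaH Δhi udhi uplo vlo nd np - deltaH Δlo udlo uphi vhi nd np =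
      (Δhi - Δlo) + (2 - nd) / 2 * (udhi - udlo) + (2 - np) / 2 * (uphi - uplo)
        + (2 * (2 - nd) - 4 * (2 - np)) * (vhi - vlo) := by
  unfold deltaH; ring

/-- A worked instance with exact rationals (no material is meant; the numbers only exhibit that the
map evaluates): `Δ^fl = 12/5`, `U_d = 9`, `U_p = 5`, `V = 2`, `n̄_d = 3/2`, `n̄_p = 7/4` give hole
occupations `h_d = 1/2`, `h_p = 1/4` (one hole per cell) and `Δ^h = 12/5 + 9/4 − 5/8 + 2·(1 − 1) = 161/40`. -/
example : deltaH (12 / 5) 9 5 2 (3 / 2) (7 / 4) = 161 / 40 := by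
  unfold deltaH; norm_num

end Summit.Ventures.CertifiedManyBodySolver.Downfold.PictureMap

end
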